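import Summits.Ventures.PercRepro.Reach
import Summits.Ventures.PercRepro.BridgeSum

/-!
# PercRepro — rows of the 1-sum and the bridge kernel identity (p1, gen 4; proofs/P1-bridge-lemma.md §1)

The marked partition of `a, b ∈ V₁`, `c, d ∈ V₂` in `G₁.bridgeSum G₂ h₁ h₂` is determined by six Booleans of the
two halves — `A = [a ~ b]`, `X = [a ~ h₁]`, `X' = [b ~ h₁]` in `G₁`, `C = [c ~ d]`, `Y = [h₂ ~ c]`, `Y' = [h₂ ~ d]`
in `G₂` — and the bridge bit `β` (`atoms4_bridgeSum`).  The C-011 kernel of an antipodal pair is then a function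
of the twelve Booleans of the two sides: with the bridge open on the X-side only the `(⊤, ⊥)` pairs survive, with
it closed only the liability pairs `(ab|cd, R)` with `R` joining each side's bridge end to exactly one mark
(`bridge_kernel_true`, `bridge_kernel_false`, 4096 cases each).
-/

namespace PercRepro

/-- The six atoms of the 1-sum partition from the 3-mark Booleans of the two halves and the bridge bit. -/
def bridgeRowVec (A X X' C Y Y' β : Bool) : Fin 6 → Bool :=
  ![A, β && (X && Y), β && (X && Y'), β && (X' && Y), β && (X' && Y'), C]

/-- Transitivity of three Booleans `[a ~ b]`, `[a ~ h]`, `[b ~ h]` read off a partition of three vertices. -/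
def Tr3 (A X X' : Bool) : Prop :=
  (A = true → X = true → X' = true) ∧ (A = true → X' = true → X = true) ∧ (X = true → X' = true → A = true)

/-- `Tr3` is decidable. -/
instance (A X X' : Bool) : Decidable (Tr3 A X X') := by unfold Tr3; infer_instance

/-- **The bridge kernel with the bridge open on the X-side**: only `(⊤, ⊥)` survives. -/
theorem bridge_kernel_true : ∀ (A X X' C Y Y' A' X'' X''' C' Y'' Y''' : Bool),
    Tr3 A X X' → Tr3 A' X'' X''' → Tr3 C Y Y' → Tr3 C' Y'' Y''' →
      kplusZ (rowOf4 (bridgeRowVec A X X' C Y Y' true)) (rowOf4 (bridgeRowVec A' X'' X''' C' Y'' Y''' false)) =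
        if A && X && X' && C && Y && Y' && !A' && !C' then 1 else 0 := by
  decide

/-- **The bridge kernel with the bridge closed on the X-side**: only the liability pairs `(ab|cd, R)` survive,
`R` joining each bridge end to exactly one of its side's marks. -/
theorem bridge_kernel_false : ∀ (A X X' C Y Y' A' X'' X''' C' Y'' Y''' : Bool),
    Tr3 A X X' → Tr3 A' X'' X''' → Tr3 C Y Y' → Tr3 C' Y'' Y''' →
      kplusZ (rowOf4 (bridgeRowVec A X X' C Y Y' false)) (rowOf4 (bridgeRowVec A' X'' X''' C' Y'' Y''' true)) =
        -(if A && C && (X'' != X''') && (Y'' != Y''') then 1 else 0) := by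
  decide

namespace MultiGraph

variable {V₁ E₁ V₂ E₂ : Type*} (G₁ : MultiGraph V₁ E₁) (G₂ : MultiGraph V₂ E₂) (h₁ : V₁) (h₂ : V₂)

open Classical in
/-- The 3-mark Booleans are transitive. -/
theorem tr3_tri (G : MultiGraph V₁ E₁) (ω : Config E₁) (a b h : V₁) :
    Tr3 (decide (G.Conn ω a b)) (decide (G.Conn ω a h)) (decide (G.Conn ω b h)) := by
  refine ⟨fun hab hah => ?_, fun hab hbh => ?_, fun hah hbh => ?_⟩
  · rw [decide_eq_true_iff] at hab hah ⊢
    exact hab.symm.trans hah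
  · rw [decide_eq_true_iff] at hab hbh ⊢
    exact hab.trans hbh
  · rw [decide_eq_true_iff] at hah hbh ⊢
    exact hah.trans hbh.symm

open Classical in
/-- The 3-mark Booleans with the bridge end first are transitive as well. -/
theorem tr3_tri' (G : MultiGraph V₁ E₁) (ω : Config E₁) (c d h : V₁) :
    Tr3 (decide (G.Conn ω c d)) (decide (G.Conn ω h c)) (decide (G.Conn ω h d)) := by
  refine ⟨fun hcd hhc => ?_, fun hcd hhd => ?_, fun hhc hhd => ?_⟩
  · rw [decide_eq_true_iff] at hcd hhc ⊢
    exact hhc.trans hcd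
  · rw [decide_eq_true_iff] at hcd hhd ⊢
    exact hhd.trans hcd.symm
  · rw [decide_eq_true_iff] at hhc hhd ⊢
    exact hhc.symm.trans hhd

open Classical in
/-- **The atoms of the 1-sum partition** of `inl a, inl b, inr c, inr d`. -/
theorem atoms4_bridgeSum (ω : Config (E₁ ⊕ (E₂ ⊕ Unit))) (a b : V₁) (c d : V₂) :
    atoms4 ((G₁.bridgeSum G₂ h₁ h₂).markedPartition ω ![Sum.inl a, Sum.inl b, Sum.inr c, Sum.inr d]) =
      bridgeRowVec (decide (G₁.Conn (leftCfg ω) a b)) (decide (G₁.Conn (leftCfg ω) a h₁))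
        (decide (G₁.Conn (leftCfg ω) b h₁)) (decide (G₂.Conn (rightCfg ω) c d))
        (decide (G₂.Conn (rightCfg ω) h₂ c)) (decide (G₂.Conn (rightCfg ω) h₂ d)) (bridgeBit ω) := by
  funext i
  rw [MultiGraph.atoms4_markedPartition]
  fin_cases i
  · show decide ((G₁.bridgeSum G₂ h₁ h₂).Conn ω (Sum.inl a) (Sum.inl b)) = _
    rw [decide_eq_decide.2 (G₁.conn_inl_inl_iff G₂ h₁ h₂ ω a b)]
    rfl
  · show decide ((G₁.bridgeSum G₂ h₁ h₂).Conn ω (Sum.inl a) (Sum.inr c)) = _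
    rw [decide_eq_decide.2 (G₁.conn_inl_inr_iff G₂ h₁ h₂ ω a c), Bool.decide_and, Bool.decide_and,
      Bool.decide_eq_true]
    rfl
  · show decide ((G₁.bridgeSum G₂ h₁ h₂).Conn ω (Sum.inl a) (Sum.inr d)) = _
    rw [decide_eq_decide.2 (G₁.conn_inl_inr_iff G₂ h₁ h₂ ω a d), Bool.decide_and, Bool.decide_and,
      Bool.decide_eq_true]
    rfl
  · show decide ((G₁.bridgeSum G₂ h₁ h₂).Conn ω (Sum.inl b) (Sum.inr c)) = _
    rw [decide_eq_decide.2 (G₁.conn_inl_inr_iff G₂ h₁ h₂ ω b c), Bool.decide_and, Bool.decide_and,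
      Bool.decide_eq_true]
    rfl
  · show decide ((G₁.bridgeSum G₂ h₁ h₂).Conn ω (Sum.inl b) (Sum.inr d)) = _
    rw [decide_eq_decide.2 (G₁.conn_inl_inr_iff G₂ h₁ h₂ ω b d), Bool.decide_and, Bool.decide_and,
      Bool.decide_eq_true]
    rfl
  · show decide ((G₁.bridgeSum G₂ h₁ h₂).Conn ω (Sum.inr c) (Sum.inr d)) = _
    rw [decide_eq_decide.2 (G₁.conn_inr_inr_iff G₂ h₁ h₂ ω c d)]
    rfl

open Classical in
/-- **The row of the 1-sum partition.** -/
theorem row4_bridgeSum (ω : Config (E₁ ⊕ (E₂ ⊕ Unit))) (a b : V₁) (c d : V₂) :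
    row4 ((G₁.bridgeSum G₂ h₁ h₂).markedPartition ω ![Sum.inl a, Sum.inl b, Sum.inr c, Sum.inr d]) =
      rowOf4 (bridgeRowVec (decide (G₁.Conn (leftCfg ω) a b)) (decide (G₁.Conn (leftCfg ω) a h₁))
        (decide (G₁.Conn (leftCfg ω) b h₁)) (decide (G₂.Conn (rightCfg ω) c d))
        (decide (G₂.Conn (rightCfg ω) h₂ c)) (decide (G₂.Conn (rightCfg ω) h₂ d)) (bridgeBit ω)) := by
  rw [row4, G₁.atoms4_bridgeSum G₂ h₁ h₂]

end MultiGraph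

end PercRepro
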